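import Literature.NumberTheory.GaloisRepresentations.SerreOpenImageGroupLemmas
import Literature.NumberTheory.EllipticCurves.Rank1Residual.X9ImageShape
import Summits.BirchSwinnertonDyer.BirchSwinnertonDyer.Theorems.SmallImageMuTransferMuTransferX9TopGenerator
import Literature.NumberTheory.GaloisRepresentations.OddSubgroupCartanNormalizerGL2Fp
import Literature.NumberTheory.EllipticCurves.SerreOpenImageNormalizerCaseProofs
import Mathlib.LinearAlgebra.Matrix.GeneralLinearGroup.Card

set_option linter.dupNamespace false

/-!
# DihedralStructureX10b — the X10b dihedral structure theorems at p = 3 (bsd-idea-5 g6; rev 2; SORRY-FREE)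

Workfile of crux idea `dihedral-artin-twin-mu-x10b` (Ideas/dihedral-artin-twin-mu-x10b.md). No `sorry`.

D0 («`Irr ∧ ¬Surj ⇒ 3 ∤ #im ρ̄_{E,3}`») is a THEOREM of the tree
(`Rank1Residual.not_dvd_card_range_galoisRepTorsion_of_irreducible_of_not_surjective`) — cited.
D1 (the X10b DIHEDRAL STRUCTURE THEOREM at `p = 3`) is proved here SORRY-FREE by the same assembly the
tree's `X9ImageShape` uses at `p ≥ 7`, minus Serre's Prop. 14 (which needs `p ≥ 5`): good ordinary
gives a split half-Cartan subgroup in the image (`exists_halfSplitCartan_le_image_of_goodOrd`), and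
Serre §4.2 b) for `p ≠ 2, 5` (`exists_cartan_normalizer_of_not_hasSurjectiveModNGaloisRep`: Prop. 17
+ complex conjugation) puts an irreducible non-surjective image in the normaliser of a Cartan subgroup
`C` without being inside `C`.  At `p = 3` the Cartan `C` may be split (3Ns, `N(C_s) ≅ D₄`: the clean
scope of the dictionary) or non-split (3Nn, `N(C_ns) ≅ SD₁₆`: residual sub-class R-CM3) — Prop. 14
does not decide it because the half split Cartan has order `2`.  D1♯ «split Cartan normaliser, or the image is the full `2`-Sylow (order 16)» is ALSO proved here
(`normalizer_splitCartan_or_card_sixteen`, needing only `Irr ∧ ¬Surj` at `3`: finite group theory in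
`GL₂(𝔽₃)` via Cayley–Hamilton, `le_normalizer_or_card_eq_sixteen`).
-/

noncomputable section

open scoped MatrixGroups
open Matrix Field WeierstrassCurve
open Literature.NumberTheory.GaloisRepresentations
open Literature.NumberTheory.GaloisRepresentations.Serre1972
open Literature.NumberTheory.EllipticCurves Literature.NumberTheory.EllipticCurves.Rank1Residual

namespace Summit.BirchSwinnertonDyer.BirchSwinnertonDyer.Cruxes.HowardContainmentAnyClassNumberX10b.DihedralCMTransfer

/-- Group-theoretic core of D0 (sorry-free): irreducible + `det` onto + proper ⇒ order prime to `p`.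
Contrapositive of `Serre1972.eq_top_or_borel_of_dvd_card`. -/
theorem not_dvd_card_of_irreducible_of_ne_top {p : ℕ} [Fact p.Prime]
    (G : Subgroup (GL (Fin 2) (ZMod p)))
    (hdet : ∀ u : (ZMod p)ˣ, ∃ g ∈ G, Matrix.GeneralLinearGroup.det g = u)
    (hirr : ∀ (v : Fin 2 → ZMod p) (hv : v ≠ 0), ¬ G ≤ eigenvectorStabilizer v hv)
    (hne : G ≠ ⊤) : ¬ p ∣ Nat.card G := by
  intro h
  rcases eq_top_or_borel_of_dvd_card G h hdet with h1 | ⟨v, hv, h2⟩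
  · exact hne h1
  · exact hirr v hv h2

/-- **D0 (IN TREE — cited, sorry-free)**: on every frame with `Irr W 3` and `¬ Surj W 3` the mod-`3`
image has order prime to `3` (hence dividing `16`). -/
theorem imagePrimeToThree (W : WeierstrassCurve ℚ) [W.IsElliptic]
    (hirr : Irr W 3) (hns : ¬ Surj W 3) : ¬ 3 ∣ Nat.card (W.galoisRepTorsion 3).range :=
  Summit.BirchSwinnertonDyer.BirchSwinnertonDyer.Rank1Residual.not_dvd_card_range_galoisRepTorsion_of_irreducible_of_not_surjective
    W 3 hirr hns

variable (W : WeierstrassCurve ℚ) [W.IsElliptic] [W.IsGloballyMinimal]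
  (Φ : Multiplicative (AddAut (geomTorsion W 3)) ≃* GL (Fin 2) (ZMod 3))
  (e : geomTorsion W 3 ≃+ (Fin 2 → ZMod 3))
  (he : ∀ (g : Multiplicative (AddAut (geomTorsion W 3))) (x : geomTorsion W 3),
    e (Multiplicative.toAdd g x) =
      ((Φ g : GL (Fin 2) (ZMod 3)) : Matrix (Fin 2) (Fin 2) (ZMod 3)) *ᵥ e x)

include he in
/-- **D1 — the X10b dihedral structure theorem at `p = 3` (SORRY-FREE).**  For `E/ℚ` with good
ORDINARY reduction at `3`, `E[3]` irreducible and `ρ̄_{E,3}` not onto (all three in `ClassX10 ∧ ¬Surj`),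
in any Serre frame `(e, Φ)` of `E[3]`: the image `G₃ = Φ(ρ̄(Γ_ℚ))` contains a split half-Cartan subgroup
`P (1 0; 0 *) P⁻¹` (the tame inertia at `3`), and there is a Cartan subgroup `C` (split or non-split)
with `G₃ ≤ N(C)` and `G₃ ⊄ C` — so the projective image is DIHEDRAL and `ρ̄_{E,3} ⊗ 𝔽₉` is induced
from the quadratic field cut out by `ρ̄⁻¹(C)`.  Assembly of tree theorems only:
`exists_halfSplitCartan_le_image_of_goodOrd` (Serre §1.11) and
`exists_cartan_normalizer_of_not_hasSurjectiveModNGaloisRep` (Serre §4.2 b), `p ≠ 2, 5`).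
[cite: Serre1972, §1.11 Cor. to Prop. 11; §2.7 Prop. 17; §4.2 b); §5.2 (iv)] -/
theorem exists_halfSplitCartan_and_cartan_normalizer_three (hord : GoodOrd W 3) (hirr : Irr W 3)
    (hns : ¬ Surj W 3) :
    ∃ P : GL (Fin 2) (ZMod 3),
      halfSplitCartan P ≤ (galoisRepTorsion W 3).range.map Φ.toMonoidHom ∧
      ∃ C ∈ cartanSubgroups (ZMod 3),
        (galoisRepTorsion W 3).range.map Φ.toMonoidHom ≤
            Subgroup.normalizer (C : Set (GL (Fin 2) (ZMod 3))) ∧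
          ¬ (galoisRepTorsion W 3).range.map Φ.toMonoidHom ≤ C := by
  have hp2 : (3 : ℕ) ≠ 2 := by decide
  have hp5 : (3 : ℕ) ≠ 5 := by decide
  obtain ⟨P, hP⟩ := exists_halfSplitCartan_le_image_of_goodOrd W 3 Φ e he hord
  obtain ⟨C, hC, hGN, hGC⟩ := W.exists_cartan_normalizer_of_not_hasSurjectiveModNGaloisRep 3 Φ e
    he hp2 hp5 (Or.inl ⟨P, hP⟩) hirr hns
  exact ⟨P, hP, C, hC, hGN, hGC⟩

include he in
/-- **D1 for the class**: `ClassX10 W 3 ∧ ¬ Surj W 3` ⇒ the dihedral structure (sorry-free). -/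
theorem ClassX10.exists_cartan_normalizer (h : ClassX10 W 3) (hns : ¬ Surj W 3) :
    ∃ C ∈ cartanSubgroups (ZMod 3),
      (galoisRepTorsion W 3).range.map Φ.toMonoidHom ≤
          Subgroup.normalizer (C : Set (GL (Fin 2) (ZMod 3))) ∧
        ¬ (galoisRepTorsion W 3).range.map Φ.toMonoidHom ≤ C := by
  obtain ⟨-, hord, hirr, -⟩ := h
  obtain ⟨P, -, C, hC, hGN, hGC⟩ :=
    exists_halfSplitCartan_and_cartan_normalizer_three W Φ e he hord hirr hns
  exact ⟨C, hC, hGN, hGC⟩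

/-! ### D1♯ — split Cartan normaliser, or the full `2`-Sylow (finite group theory in `GL₂(𝔽₃)`) -/

open Literature.NumberTheory.GaloisRepresentations.FLS2015 in
/-- If `g c g⁻¹ ∈ 𝔽_p[c]` for an involution `c` of determinant `-1`, then `g` normalises the split
Cartan subgroup `𝔽_p[c]ˣ` (`𝔽_p[g c g⁻¹] = 𝔽_p[c]`, as in `Serre1972.le_normalizer_unitGroup_adjoinElem`). -/
theorem mem_normalizer_unitGroup_adjoinElem_of_conj_mem {p : ℕ} [Fact p.Prime] (hp2 : p ≠ 2)
    {c g : GL (Fin 2) (ZMod p)} (hcc : c * c = 1) (hcdet : GeneralLinearGroup.det c = -1)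
    (h : ((g * c * g⁻¹ : GL (Fin 2) (ZMod p)) : Matrix (Fin 2) (Fin 2) (ZMod p)) ∈
      adjoinElem (c : Matrix (Fin 2) (Fin 2) (ZMod p))) :
    g ∈ Subgroup.normalizer
      (unitGroup (adjoinElem (c : Matrix (Fin 2) (Fin 2) (ZMod p))) : Set (GL (Fin 2) (ZMod p))) := by
  have hgu : IsUnit (g : Matrix (Fin 2) (Fin 2) (ZMod p)).det := (GL2.det_ne_zero g).isUnit
  have hmat : ((g * c * g⁻¹ : GL (Fin 2) (ZMod p)) : Matrix (Fin 2) (Fin 2) (ZMod p)) =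
      (g : Matrix (Fin 2) (Fin 2) (ZMod p)) * (c : Matrix (Fin 2) (Fin 2) (ZMod p)) *
        (g : Matrix (Fin 2) (Fin 2) (ZMod p))⁻¹ := by
    simp only [Units.val_mul, Matrix.coe_units_inv]
  have hns : ∀ s : ZMod p, ((g * c * g⁻¹ : GL (Fin 2) (ZMod p)) : Matrix (Fin 2) (Fin 2) (ZMod p))
      ≠ s • 1 := by
    intro s hs
    apply ne_smul_one_of_mul_self_eq_one hp2 hcc hcdet s
    rw [hmat] at hs
    calc (c : Matrix (Fin 2) (Fin 2) (ZMod p))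
        = (g : Matrix (Fin 2) (Fin 2) (ZMod p))⁻¹ *
            ((g : Matrix (Fin 2) (Fin 2) (ZMod p)) * (c : Matrix (Fin 2) (Fin 2) (ZMod p)) *
              (g : Matrix (Fin 2) (Fin 2) (ZMod p))⁻¹) *
            (g : Matrix (Fin 2) (Fin 2) (ZMod p)) := (conj_cancel' _ hgu _).symm
      _ = s • 1 := by rw [hs, Matrix.mul_smul, Matrix.mul_one, Matrix.smul_mul,
            Matrix.nonsing_inv_mul _ hgu]
  have key : adjoinElem ((g : Matrix (Fin 2) (Fin 2) (ZMod p)) * (c : Matrix (Fin 2) (Fin 2) (ZMod p)) *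
      (g : Matrix (Fin 2) (Fin 2) (ZMod p))⁻¹) = adjoinElem (c : Matrix (Fin 2) (Fin 2) (ZMod p)) := by
    rw [← hmat]; exact adjoinElem_eq_of_mem h hns
  rw [Subgroup.mem_normalizer_iff]
  intro k
  simp only [mem_unitGroup_iff, Units.val_mul, Matrix.coe_units_inv]
  constructor
  · intro hk
    have := conj_mem_adjoinElem hk (Matrix.mul_nonsing_inv _ hgu)
    rwa [key] at this
  · intro hk
    have := conj_mem_adjoinElem hk (Matrix.nonsing_inv_mul _ hgu)
    rw [conj_cancel' _ hgu] at this
    have hmem : (g : Matrix (Fin 2) (Fin 2) (ZMod p))⁻¹ * (c : Matrix (Fin 2) (Fin 2) (ZMod p)) *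
        (g : Matrix (Fin 2) (Fin 2) (ZMod p)) ∈ adjoinElem (c : Matrix (Fin 2) (Fin 2) (ZMod p)) := by
      have hc' : (c : Matrix (Fin 2) (Fin 2) (ZMod p)) ∈
          adjoinElem ((g : Matrix (Fin 2) (Fin 2) (ZMod p)) * (c : Matrix (Fin 2) (Fin 2) (ZMod p)) *
            (g : Matrix (Fin 2) (Fin 2) (ZMod p))⁻¹) := by
        rw [key]; exact self_mem_adjoinElem _
      have h2 := conj_mem_adjoinElem hc' (Matrix.nonsing_inv_mul _ hgu)
      rwa [conj_cancel' _ hgu] at h2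
    have hns' : ∀ s : ZMod p, (g : Matrix (Fin 2) (Fin 2) (ZMod p))⁻¹ * (c : Matrix (Fin 2) (Fin 2) (ZMod p)) *
        (g : Matrix (Fin 2) (Fin 2) (ZMod p)) ≠ s • 1 := by
      intro s hs
      apply ne_smul_one_of_mul_self_eq_one hp2 hcc hcdet s
      calc (c : Matrix (Fin 2) (Fin 2) (ZMod p))
          = (g : Matrix (Fin 2) (Fin 2) (ZMod p)) *
              ((g : Matrix (Fin 2) (Fin 2) (ZMod p))⁻¹ * (c : Matrix (Fin 2) (Fin 2) (ZMod p)) *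
                (g : Matrix (Fin 2) (Fin 2) (ZMod p))) *
              (g : Matrix (Fin 2) (Fin 2) (ZMod p))⁻¹ := (conj_cancel _ hgu _).symm
        _ = s • 1 := by rw [hs, Matrix.mul_smul, Matrix.mul_one, Matrix.smul_mul,
              Matrix.mul_nonsing_inv _ hgu]
    have key' : adjoinElem ((g : Matrix (Fin 2) (Fin 2) (ZMod p))⁻¹ * (c : Matrix (Fin 2) (Fin 2) (ZMod p)) *
        (g : Matrix (Fin 2) (Fin 2) (ZMod p))) = adjoinElem (c : Matrix (Fin 2) (Fin 2) (ZMod p)) :=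
      adjoinElem_eq_of_mem hmem hns'
    rwa [key'] at this

/-- `|GL₂(𝔽₃)| = 48`. -/
theorem card_GL2_zmod3 : Nat.card (GL (Fin 2) (ZMod 3)) = 48 := by
  rw [Matrix.card_GL_field]
  simp [Fin.prod_univ_two, ZMod.card]

open Literature.NumberTheory.GaloisRepresentations.FLS2015 in
/-- **Finite-group core of D1♯.**  Let `G ≤ GL₂(𝔽₃)` have order prime to `3` and contain an
involution `c` with `det c = -1`.  Then either `G` normalises the split Cartan subgroup `𝔽₃[c]ˣ`,
or `|G| = 16` (a `2`-Sylow subgroup of `GL₂(𝔽₃)`).  Proof: if some conjugate `c' = g c g⁻¹` is not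
in `𝔽₃[c]`, put `x = c' c ∈ G ∩ SL₂(𝔽₃)`, `x ≠ ±1`; Cayley–Hamilton `x² = tr(x)·x - 1` with
`tr x ∈ {0, ±1}`: `tr x = ±1` gives an element of order `3` or `6` (excluded), `tr x = 0` gives
`x² = -1`, `x c x⁻¹ = -c`, so `⟨x⟩ ⊊ G ∩ N(𝔽₃[c]ˣ) ⊊ G` (`c`, resp. `g`) forces `16 ∣ |G| ∣ 16`. -/
theorem le_normalizer_or_card_eq_sixteen (G : Subgroup (GL (Fin 2) (ZMod 3)))
    (h3 : ¬ 3 ∣ Nat.card G) {c : GL (Fin 2) (ZMod 3)} (hcG : c ∈ G) (hcc : c * c = 1)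
    (hcdet : GeneralLinearGroup.det c = -1) :
    G ≤ Subgroup.normalizer
        (unitGroup (adjoinElem (c : Matrix (Fin 2) (Fin 2) (ZMod 3))) : Set (GL (Fin 2) (ZMod 3))) ∨
      Nat.card G = 16 := by
  classical
  have hp2 : (3 : ℕ) ≠ 2 := by decide
  by_cases hall : ∀ g ∈ G, ((g * c * g⁻¹ : GL (Fin 2) (ZMod 3)) : Matrix (Fin 2) (Fin 2) (ZMod 3)) ∈
      adjoinElem (c : Matrix (Fin 2) (Fin 2) (ZMod 3))
  · exact Or.inl fun g hg ↦ mem_normalizer_unitGroup_adjoinElem_of_conj_mem hp2 hcc hcdet (hall g hg)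
  right
  push Not at hall
  obtain ⟨g, hgG, hg⟩ := hall
  set N := Subgroup.normalizer
    (unitGroup (adjoinElem (c : Matrix (Fin 2) (Fin 2) (ZMod 3))) : Set (GL (Fin 2) (ZMod 3))) with hNdef
  set c' : GL (Fin 2) (ZMod 3) := g * c * g⁻¹ with hc'def
  have hc'G : c' ∈ G := G.mul_mem (G.mul_mem hgG hcG) (G.inv_mem hgG)
  have hc'c' : c' * c' = 1 := by
    rw [hc'def, show g * c * g⁻¹ * (g * c * g⁻¹) = g * (c * c) * g⁻¹ by group, hcc, mul_one,
      mul_inv_cancel]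
  have hc'det : GeneralLinearGroup.det c' = -1 := by
    rw [hc'def, map_mul, map_mul, map_inv, hcdet, mul_comm (GeneralLinearGroup.det g) (-1),
      mul_assoc, mul_inv_cancel, mul_one]
  set x : GL (Fin 2) (ZMod 3) := c' * c with hxdef
  have hxG : x ∈ G := G.mul_mem hc'G hcG
  have hdetx : GeneralLinearGroup.det x = 1 := by
    rw [hxdef, map_mul, hc'det, hcdet, neg_mul_neg, one_mul]
  have hc'_eq : c' = x * c := by rw [hxdef, mul_assoc, hcc, mul_one]
  have hx1 : x ≠ 1 := by
    intro h; apply hg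
    rw [hc'_eq, h, one_mul]
    exact self_mem_adjoinElem _
  have hxm1 : x ≠ -1 := by
    intro h; apply hg
    rw [hc'_eq, h, neg_one_mul, Units.val_neg]
    exact ⟨0, -1, by rw [zero_smul, zero_add, neg_one_smul]⟩
  -- Cayley–Hamilton for `x`
  set X : Matrix (Fin 2) (Fin 2) (ZMod 3) := (x : Matrix (Fin 2) (Fin 2) (ZMod 3)) with hXdef
  have hdetX : X.det = 1 := by
    have := congrArg (fun u : (ZMod 3)ˣ ↦ (u : ZMod 3)) hdetx
    simpa only [GeneralLinearGroup.val_det_apply, Units.val_one] using this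
  have hCH : X * X = X.trace • X - 1 := by
    have := DeligneSerre1974.TwoByTwo.mul_self_eq X
    rwa [hdetX, one_smul] at this
  have val_inj : ∀ {y z : GL (Fin 2) (ZMod 3)},
      (y : Matrix (Fin 2) (Fin 2) (ZMod 3)) = (z : Matrix (Fin 2) (Fin 2) (ZMod 3)) → y = z :=
    fun h ↦ Units.ext h
  have hXpow : ∀ n : ℕ, ((x ^ n : GL (Fin 2) (ZMod 3)) : Matrix (Fin 2) (Fin 2) (ZMod 3)) = X ^ n :=
    fun n ↦ by rw [Units.val_pow_eq_pow_val]
  have neg_one_ne : (-1 : Matrix (Fin 2) (Fin 2) (ZMod 3)) ≠ 1 := by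
    intro h
    have h00 : (-1 : Matrix (Fin 2) (Fin 2) (ZMod 3)) 0 0 = (1 : Matrix (Fin 2) (Fin 2) (ZMod 3)) 0 0 := by
      rw [h]
    simp only [Matrix.neg_apply, Matrix.one_apply_eq] at h00
    exact absurd h00 (by decide)
  have htr : X.trace = 0 ∨ X.trace = 1 ∨ X.trace = -1 := by
    generalize X.trace = t
    revert t; decide
  -- an element of order `3` in `G` is excluded
  have horder3 : ∀ y ∈ G, y ^ 3 = 1 → y ≠ 1 → False := by
    intro y hyG hy3 hy1
    haveI : Fact (Nat.Prime 3) := ⟨Nat.prime_three⟩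
    have ho : orderOf y = 3 := orderOf_eq_prime hy3 hy1
    have hdvd := G.orderOf_dvd_natCard hyG
    rw [ho] at hdvd
    exact h3 hdvd
  rcases htr with h0 | h1 | hm1
  · -- `tr x = 0`: `x² = -1`
    have hXX : X * X = -1 := by rw [hCH, h0, zero_smul, zero_sub]
    have hxx : x * x = -1 := val_inj (by rw [Units.val_mul, Units.val_neg, Units.val_one]; exact hXX)
    have hxinv : x⁻¹ = -x := inv_eq_of_mul_eq_one_right (by rw [mul_neg, hxx, neg_neg])
    -- `x c x⁻¹ = -c`
    have hxcx : x * c * x⁻¹ = -c := by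
      rw [hxinv, mul_neg, hxdef, mul_assoc c' c c, hcc, mul_one, ← mul_assoc, hc'c', one_mul]
    have hxN : x ∈ N := by
      apply mem_normalizer_unitGroup_adjoinElem_of_conj_mem hp2 hcc hcdet
      rw [hxcx, Units.val_neg]
      exact ⟨0, -1, by rw [zero_smul, zero_add, neg_one_smul]⟩
    have hcN : c ∈ N := by
      apply mem_normalizer_unitGroup_adjoinElem_of_conj_mem hp2 hcc hcdet
      rw [mul_inv_cancel_right]
      exact self_mem_adjoinElem _
    have hgN : g ∉ N := by
      intro hgN'
      apply hg
      have hcU : c ∈ unitGroup (adjoinElem (c : Matrix (Fin 2) (Fin 2) (ZMod 3))) :=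
        mem_unitGroup_iff.mpr (self_mem_adjoinElem _)
      exact mem_unitGroup_iff.mp ((Subgroup.mem_normalizer_iff.mp hgN' c).mp hcU)
    -- orders
    have hx2 : ¬ x ^ 2 ^ 1 = 1 := by
      rw [pow_one, sq, hxx]
      intro h
      apply neg_one_ne
      have h' := congrArg (fun u : GL (Fin 2) (ZMod 3) ↦ (u : Matrix (Fin 2) (Fin 2) (ZMod 3))) h
      simpa only [Units.val_neg, Units.val_one] using h'
    have hx4 : x ^ 2 ^ (1 + 1) = 1 := by
      rw [show 2 ^ (1 + 1) = 2 * 2 from rfl, pow_mul, sq x, hxx, neg_sq, one_pow]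
    haveI : Fact (Nat.Prime 2) := ⟨Nat.prime_two⟩
    have hox : orderOf x = 4 := by
      have := orderOf_eq_prime_pow hx2 hx4
      simpa using this
    set H := G ⊓ N with hHdef
    have hzH : Subgroup.zpowers x ≤ H := by
      rw [Subgroup.zpowers_le]; exact Subgroup.mem_inf.mpr ⟨hxG, hxN⟩
    have hcH : c ∈ H := Subgroup.mem_inf.mpr ⟨hcG, hcN⟩
    have hcz : c ∉ Subgroup.zpowers x := by
      intro h
      obtain ⟨k, hk⟩ := Subgroup.mem_zpowers_iff.mp h
      have : GeneralLinearGroup.det c = 1 := by rw [← hk, map_zpow, hdetx, _root_.one_zpow]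
      rw [hcdet] at this
      exact absurd this (by decide)
    have hcardz : Nat.card (Subgroup.zpowers x) = 4 := by rw [Nat.card_zpowers, hox]
    haveI : Finite H := inferInstance
    have h4H : 4 ∣ Nat.card H := hcardz ▸ Subgroup.card_dvd_of_le hzH
    have hH4 : Nat.card H ≠ 4 := by
      intro h
      have : Subgroup.zpowers x = H :=
        Subgroup.eq_of_le_of_card_ge hzH (by rw [h, hcardz])
      exact hcz (this ▸ hcH)
    have hHpos : 0 < Nat.card H := Nat.card_pos
    have hH8 : 8 ≤ Nat.card H := by
      obtain ⟨k, hk⟩ := h4H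
      omega
    have hHG : Nat.card H ∣ Nat.card G := Subgroup.card_dvd_of_le inf_le_left
    have hHG' : Nat.card H ≠ Nat.card G := by
      intro h
      have hHG2 : H = G := Subgroup.eq_of_le_of_card_ge inf_le_left (by rw [h])
      have hgH : g ∈ H := by rw [hHG2]; exact hgG
      exact hgN (Subgroup.mem_inf.mp hgH).2
    have hG16 : 16 ≤ Nat.card G := by
      have hGpos : 0 < Nat.card G := Nat.card_pos
      obtain ⟨k, hk⟩ := hHG
      have hk0 : k ≠ 0 := by rintro rfl; rw [mul_zero] at hk; omega
      have hk1 : k ≠ 1 := by rintro rfl; rw [mul_one] at hk; exact hHG' hk.symm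
      have hk2 : 2 ≤ k := by omega
      calc 16 = 8 * 2 := rfl
        _ ≤ Nat.card H * k := Nat.mul_le_mul hH8 hk2
        _ = Nat.card G := hk.symm
    -- `|G| ∣ 48` and `3 ∤ |G|` give `|G| ∣ 16`
    have hG48 : Nat.card G ∣ 16 * 3 := by
      have := Subgroup.card_subgroup_dvd_card G
      rwa [card_GL2_zmod3] at this
    have hcop : Nat.Coprime (Nat.card G) 3 :=
      (Nat.Prime.coprime_iff_not_dvd Nat.prime_three).mpr h3 |>.symm
    have hG16' : Nat.card G ∣ 16 := hcop.dvd_of_dvd_mul_right hG48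
    exact le_antisymm (Nat.le_of_dvd (by norm_num) hG16') hG16
  · -- `tr x = 1`: `x² = x - 1`, `x³ = -1`, so `x²` has order `3`
    have hXX : X * X = X - 1 := by rw [hCH, h1, one_smul]
    have hX3 : X ^ 3 = -1 := by
      rw [pow_succ, sq, hXX, sub_mul, one_mul, hXX]; abel
    have hx6 : (x ^ 2) ^ 3 = 1 := val_inj (by
      rw [← pow_mul, hXpow, Units.val_one, show 2 * 3 = 3 * 2 from rfl, pow_mul, hX3, neg_sq, one_pow])
    have hx2 : x ^ 2 ≠ 1 := by
      intro h
      apply hxm1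
      apply val_inj
      have hm : X * X = 1 := by rw [← sq, ← hXpow, h, Units.val_one]
      rw [hm] at hXX
      rw [Units.val_neg, Units.val_one]
      have hX2 : X = 1 + 1 := by rw [eq_comm, sub_eq_iff_eq_add] at hXX; exact hXX
      rw [← hXdef, hX2]
      ext i j
      fin_cases i <;> fin_cases j <;>
        simp only [Matrix.add_apply, Matrix.neg_apply, Matrix.one_apply] <;> decide
    exact (horder3 (x ^ 2) (G.pow_mem hxG 2) hx6 hx2).elim
  · -- `tr x = -1`: `x² = -x - 1`, `x³ = 1`
    have hXX : X * X = -X - 1 := by rw [hCH, hm1, neg_one_smul]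
    have hX3 : X ^ 3 = 1 := by
      rw [pow_succ, sq, hXX]
      have : (-X - 1) * X = -(X * X) - X := by noncomm_ring
      rw [this, hXX]; abel
    have hx3 : x ^ 3 = 1 := val_inj (by rw [hXpow, hX3, Units.val_one])
    exact (horder3 x hxG hx3 hx1).elim

open Literature.NumberTheory.GaloisRepresentations.FLS2015 in
omit [W.IsGloballyMinimal] in
include he in
/-- **D1♯ (PROVED): split Cartan normaliser, or the full `2`-Sylow.**  For `E/ℚ` with `E[3]`
irreducible and `ρ̄_{E,3}` not onto — NO hypothesis at `3` (per the critic's mutation finding V#60: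
complex conjugation alone supplies the non-central involution) — in any Serre frame `(e, Φ)`: either the
image normalises a SPLIT Cartan subgroup (3Ns/3Cs-type, the dictionary's clean scope: `𝔽₃[c]ˣ` for the
complex conjugation `c`), or the image has order `16`, i.e. is a `2`-Sylow subgroup `= N(C_ns(3)) ≅ SD₁₆`
(3Nn, residual sub-class R-CM3).  Ingredients: D0 (`3 ∤ #G₃`), complex conjugation in the frame
(`exists_conj_mem_map_range`), the finite-group core `le_normalizer_or_card_eq_sixteen`, and
`𝔽₃[c]ˣ = splitCartan Q` (`FLS2015.exists_unitGroup_adjoinElem_eq_splitCartan_of_mul_self_eq_one`). -/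
theorem normalizer_splitCartan_or_card_sixteen (hirr : Irr W 3) (hns : ¬ Surj W 3) :
    (∃ P : GL (Fin 2) (ZMod 3), (W.galoisRepTorsion 3).range.map Φ.toMonoidHom ≤
        Subgroup.normalizer (splitCartan P : Set (GL (Fin 2) (ZMod 3)))) ∨
      Nat.card (W.galoisRepTorsion 3).range = 16 := by
  have hp2 : (3 : ℕ) ≠ 2 := by decide
  set G := (W.galoisRepTorsion 3).range.map Φ.toMonoidHom with hGdef
  have hcardG : Nat.card G = Nat.card (W.galoisRepTorsion 3).range :=
    Subgroup.card_map_of_injective (f := Φ.toMonoidHom) Φ.injective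
  have h3 : ¬ 3 ∣ Nat.card G := by rw [hcardG]; exact imagePrimeToThree W hirr hns
  obtain ⟨c, hcG, hcc, hcdetM⟩ := W.exists_conj_mem_map_range 3 Φ e he
  have hcdet : GeneralLinearGroup.det c = -1 :=
    Units.ext (by simpa only [GeneralLinearGroup.val_det_apply, Units.val_neg, Units.val_one] using hcdetM)
  rcases le_normalizer_or_card_eq_sixteen G h3 hcG hcc hcdet with hle | h16
  · obtain ⟨Q, hQ⟩ := exists_unitGroup_adjoinElem_eq_splitCartan_of_mul_self_eq_one hp2 hcc hcdet
    exact Or.inl ⟨Q, hQ ▸ hle⟩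
  · exact Or.inr (by rw [← hcardG]; exact h16)

end Summit.BirchSwinnertonDyer.BirchSwinnertonDyer.Cruxes.HowardContainmentAnyClassNumberX10b.DihedralCMTransfer
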